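import Summits.Schanuel.Schanuel.Theorems.RootDecomp1ResidueSieveFourExp

/-!
# RootDecomp1ResidueSieve — continuation (RootDecomp1ResidueSieveLogPi): §3 member z* = (π, πi, log π): ℚ-free, plain, dim(V ∩ ℚ̄) ≤ 1, a ≥ 1, v = 2 (Nesterenko on the value side) — member_piILogPi; Schanuel at z* OPEN (schanuel_piILogPi_iff)

Part of the four-file split (400-line rule) of lens 1's gen-16 node «ResidueSieve» = HOME/decomp-schanuel-lens-1/g16/RootDecomp1ResidueSieve.lean (sha256 563fa3ea…, 1084 l; ROUND 16 of
route-Schanuel-RootDecomp1, THEOREM ROUND; critic VERDICT 2026-08-30T18:15:03Z ACCEPTED; `--supports stmt-Schanuel-30353`); shared namespace `Summit.Schanuel.Schanuel.Theorems.RootDecomp1ResidueSieve`, node header block repeated; the first part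
(`RootDecomp1ResidueSieveCells`) carries the node docstring. WORDING OF RECORD (critic, binding): «D₃ sieve: residue = Cell(1,1) ∪ Cell(2,0); Cell(2,0) ∩ arg-rich power planes decided CONDITIONALLY on
FourExponentialsConjecture (member z_F certified); D decided (holds) at z* = (π, πi, log π) ON THE DISJOINT STRATUM (ε = 0 is the item's binder) by a = 1, v = 2 (Nesterenko) — Schanuel at z* OPEN;
value-rich members are calibration-grade». Sorry-free; standard axioms. Nothing here proves Schanuel; rung 0.
-/


noncomputable section

namespace Summit.Schanuel.Schanuel.Theorems.RootDecomp1ResidueSieve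

open Complex IntermediateField Module Polynomial
open Literature.NumberTheory.Transcendental (exists_nsmul_mem_span_int nesterenko transcendental_pi_holds
  FourExponentialsConjecture)
open Summit.Schanuel.Schanuel.Theorems.RootDecomp1EAnchor (isAlgebraic_of_mem_adjoin isAlgebraic_mul isAlgebraic_add
  trdeg_adjoin_union_le trdeg_adjoin_le_nat trdeg_adjoin_le_of_isAlgebraic exists_nat_eq_of_le_natCast)
open Summit.Schanuel.Schanuel.Theorems.RootDecomp1EEStableRung (one_le_trdeg_adjoin_of_transcendental
  mul_mem_span_of_gens)
open Summit.Schanuel.Schanuel.Theorems.RootDecomp1ArgumentCells (trdeg_args_le trdeg_vals_le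
  le_trdeg_of_algebraicIndependent_mem le_valDegree_of_exp_algebraic_mem algebraicIndependent_pi_exp_pi
  trdeg_args_le_one_of_isAlgebraic_adjoin_singleton)
open Summit.Schanuel.Schanuel.Theorems.RootDecomp1ValueCells (exp_mem_vals_of_mem_span_int exp_isAlgebraic_vals_of_mem_span)
open Summit.Schanuel.Schanuel.Theorems.RootDecomp1AdditiveCells (linearIndependent_mul_left le_trdeg_of_additive_cert)
open Summit.Schanuel.Schanuel.Theorems.RootDecomp1AdditiveCellsD (pair_one_linearIndependent)

/-- `π` is transcendental as a complex number (tree theorem `transcendental_pi_holds`, transported along `ℝ → ℂ`). -/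
private theorem transcendental_pi_complex : Transcendental ℚ (Real.pi : ℂ) :=
  (transcendental_algebraMap_iff (R := ℚ) (A := ℂ) Complex.ofReal_injective).mpr transcendental_pi_holds


/-! ### Member `z* = (π, πi, log π)` -/

/-- `z* = (π, πi, log π)`. -/
def piILogPi : Fin 3 → ℂ := ![(Real.pi : ℂ), (Real.pi : ℂ) * I, (Real.log Real.pi : ℂ)]

/-- `piILogPi 0 = (Real.pi : ℂ)`. -/
@[simp] theorem piILogPi_zero : piILogPi 0 = (Real.pi : ℂ) := rfl
/-- `piILogPi 1 = (Real.pi : ℂ) * I`. -/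
@[simp] theorem piILogPi_one : piILogPi 1 = (Real.pi : ℂ) * I := rfl
/-- `piILogPi 2 = (Real.log Real.pi : ℂ)`. -/
@[simp] theorem piILogPi_two : piILogPi 2 = (Real.log Real.pi : ℂ) := rfl

/-- `e^{log π} = π`. -/
theorem cexp_log_pi : cexp (Real.log Real.pi : ℂ) = (Real.pi : ℂ) := by
  rw [← Complex.ofReal_exp, Real.exp_log Real.pi_pos]

/-- **`π` is not algebraic over `ℚ(e^π)`** (Nesterenko). -/
theorem not_isAlgebraic_pi_over_expPi (hN : nesterenko) :
    ¬ IsAlgebraic ↥(adjoin ℚ ({cexp (Real.pi : ℂ)} : Set ℂ)) (Real.pi : ℂ) :=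
  not_isAlgebraic_of_algebraicIndependent_pair (algebraicIndependent_expPi_pi hN)

/-- **INTEGER RELATIONS `A·π + B·log π = 0` ARE TRIVIAL** (Nesterenko): `B ≠ 0` would give `π^B = (e^π)^{−A}`,
making `π` algebraic over `ℚ(e^π)`. -/
theorem int_rel_pi_logPi (hN : nesterenko) (A B : ℤ)
    (h : (A : ℂ) * (Real.pi : ℂ) + (B : ℂ) * (Real.log Real.pi : ℂ) = 0) : A = 0 ∧ B = 0 := by
  have hπ0 : (Real.pi : ℂ) ≠ 0 := by exact_mod_cast Real.pi_ne_zero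
  by_cases hB : B = 0
  · subst hB
    refine ⟨?_, rfl⟩
    have hA : (A : ℂ) * (Real.pi : ℂ) = 0 := by simpa using h
    exact_mod_cast (mul_eq_zero.mp hA).resolve_right hπ0
  · exfalso
    have hexp : (Real.pi : ℂ) ^ B = cexp (Real.pi : ℂ) ^ (-A) := by
      have e1 : cexp ((B : ℂ) * (Real.log Real.pi : ℂ)) = (Real.pi : ℂ) ^ B := by
        rw [Complex.exp_int_mul, cexp_log_pi]
      have e2 : cexp (((-A : ℤ) : ℂ) * (Real.pi : ℂ)) = cexp (Real.pi : ℂ) ^ (-A) := Complex.exp_int_mul _ _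
      have e3 : (B : ℂ) * (Real.log Real.pi : ℂ) = ((-A : ℤ) : ℂ) * (Real.pi : ℂ) := by
        push_cast
        linear_combination h
      rw [← e1, e3, e2]
    apply not_isAlgebraic_pi_over_expPi hN
    set K := adjoin ℚ ({cexp (Real.pi : ℂ)} : Set ℂ) with hK
    have hwK : cexp (Real.pi : ℂ) ^ (-A) ∈ K := zpow_mem (mem_adjoin_simple_self ℚ _) _
    obtain ⟨m, hm | hm⟩ := Int.eq_nat_or_neg B
    · have hm0 : 0 < m := by omega
      have hpow : (Real.pi : ℂ) ^ m = cexp (Real.pi : ℂ) ^ (-A) := by rw [← hexp, hm, zpow_natCast]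
      refine ⟨X ^ m - Polynomial.C ⟨_, hwK⟩, X_pow_sub_C_ne_zero hm0 _, ?_⟩
      simp [hpow]
    · have hm0 : 0 < m := by omega
      have hpow : (Real.pi : ℂ) ^ m = (cexp (Real.pi : ℂ) ^ (-A))⁻¹ := by
        rw [← hexp, hm, zpow_neg, zpow_natCast, inv_inv]
      refine ⟨X ^ m - Polynomial.C ⟨_, inv_mem hwK⟩, X_pow_sub_C_ne_zero hm0 _, ?_⟩
      simp [hpow]

/-- **`(π, log π)` IS ℚ-FREE** (Nesterenko; note that even `log π ∉ ℚ` alone is not known otherwise). -/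
theorem linearIndependent_pi_logPi (hN : nesterenko) :
    LinearIndependent ℚ ![(Real.pi : ℂ), (Real.log Real.pi : ℂ)] := by
  rw [LinearIndependent.pair_iff]
  intro s t hst
  have h : (s : ℂ) * (Real.pi : ℂ) + (t : ℂ) * (Real.log Real.pi : ℂ) = 0 := by
    simpa [Rat.smul_def] using hst
  have hs' : (s : ℂ) * (s.den : ℂ) = (s.num : ℂ) := by exact_mod_cast Rat.mul_den_eq_num s
  have ht' : (t : ℂ) * (t.den : ℂ) = (t.num : ℂ) := by exact_mod_cast Rat.mul_den_eq_num t
  have hrel : ((s.num * t.den : ℤ) : ℂ) * (Real.pi : ℂ) + ((t.num * s.den : ℤ) : ℂ) * (Real.log Real.pi : ℂ) = 0 := by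
    push_cast
    rw [← hs', ← ht']
    linear_combination ((s.den : ℂ) * (t.den : ℂ)) * h
  obtain ⟨hA, hB⟩ := int_rel_pi_logPi hN _ _ hrel
  have hsn : s.num = 0 := by
    rcases mul_eq_zero.mp hA with h0 | h0
    · exact h0
    · exact absurd (by exact_mod_cast h0) t.den_ne_zero
  have htn : t.num = 0 := by
    rcases mul_eq_zero.mp hB with h0 | h0
    · exact h0
    · exact absurd (by exact_mod_cast h0) s.den_ne_zero
  exact ⟨Rat.zero_of_num_zero hsn, Rat.zero_of_num_zero htn⟩

/-- **`z*` IS ℚ-FREE.** -/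
theorem piILogPi_linearIndependent (hN : nesterenko) : LinearIndependent ℚ piILogPi := by
  rw [Fintype.linearIndependent_iff]
  intro g hg
  have hsum : (g 0 : ℂ) * (Real.pi : ℂ) + (g 1 : ℂ) * ((Real.pi : ℂ) * I) + (g 2 : ℂ) * (Real.log Real.pi : ℂ) = 0 := by
    simpa [Fin.sum_univ_three, Rat.smul_def, piILogPi] using hg
  have him := congrArg Complex.im hsum
  simp only [Complex.add_im, Complex.mul_im, Complex.ratCast_re, Complex.ratCast_im, Complex.ofReal_re,
    Complex.ofReal_im, Complex.I_re, Complex.I_im, Complex.mul_re, Complex.zero_im] at him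
  have hg1 : g 1 = 0 := by
    have : (g 1 : ℝ) * Real.pi = 0 := by linarith [him]
    exact_mod_cast (mul_eq_zero.mp this).resolve_right Real.pi_ne_zero
  rw [hg1] at hsum
  simp only [Rat.cast_zero, zero_mul, add_zero] at hsum
  obtain ⟨h0, h2⟩ := (LinearIndependent.pair_iff.mp (linearIndependent_pi_logPi hN)) (g 0) (g 2)
    (by simpa [Rat.smul_def] using hsum)
  intro i
  fin_cases i
  · exact h0
  · exact hg1
  · exact h2

/-- Membership in `span_ℚ z*` in coordinates. -/
theorem mem_span_piILogPi_iff {v : ℂ} :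
    v ∈ Submodule.span ℚ (Set.range piILogPi) ↔
      ∃ c : Fin 3 → ℚ, (c 0 : ℂ) * (Real.pi : ℂ) + (c 1 : ℂ) * ((Real.pi : ℂ) * I) +
        (c 2 : ℂ) * (Real.log Real.pi : ℂ) = v := by
  rw [Submodule.mem_span_range_iff_exists_fun]
  refine exists_congr fun c => ?_
  simp [Fin.sum_univ_three, Rat.smul_def, piILogPi]

/-- Real and imaginary parts of a point of `span_ℚ z*`. -/
theorem re_im_of_coords (c : Fin 3 → ℚ) :
    ((c 0 : ℂ) * (Real.pi : ℂ) + (c 1 : ℂ) * ((Real.pi : ℂ) * I) + (c 2 : ℂ) * (Real.log Real.pi : ℂ)).re =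
        (c 0 : ℝ) * Real.pi + (c 2 : ℝ) * Real.log Real.pi ∧
      ((c 0 : ℂ) * (Real.pi : ℂ) + (c 1 : ℂ) * ((Real.pi : ℂ) * I) + (c 2 : ℂ) * (Real.log Real.pi : ℂ)).im =
        (c 1 : ℝ) * Real.pi := by
  constructor <;>
    simp [Complex.add_re, Complex.mul_re, Complex.add_im, Complex.mul_im, Complex.ratCast_re, Complex.ratCast_im,
      Complex.ofReal_re, Complex.ofReal_im, Complex.I_re, Complex.I_im]

/-- **`z*` IS PLAIN**: every multiplier of `span_ℚ (π, πi, log π)` is rational (so `z*` lies outside the E-stable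
stratum). -/
theorem piILogPi_plain (hN : nesterenko) {β : ℂ}
    (hβ : ∀ i, β * piILogPi i ∈ Submodule.span ℚ (Set.range piILogPi)) : β ∈ Set.range (algebraMap ℚ ℂ) := by
  have hπ0 : (Real.pi : ℝ) ≠ 0 := Real.pi_ne_zero
  have hli := (LinearIndependent.pair_iff.mp (linearIndependent_pi_logPi hN))
  -- `β π = c₀ π + c₁ πi + c₂ log π` and `β πi = d₀ π + d₁ πi + d₂ log π`
  obtain ⟨c, hc⟩ := mem_span_piILogPi_iff.mp (hβ 0)
  obtain ⟨d, hd⟩ := mem_span_piILogPi_iff.mp (hβ 1)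
  simp only [piILogPi_zero, piILogPi_one] at hc hd
  -- multiply the first by `i` and compare with the second: `i·(c₀π + c₁πi + c₂ log π) = d₀π + d₁πi + d₂ log π`
  have hcmp : I * ((c 0 : ℂ) * (Real.pi : ℂ) + (c 1 : ℂ) * ((Real.pi : ℂ) * I) + (c 2 : ℂ) * (Real.log Real.pi : ℂ)) =
      (d 0 : ℂ) * (Real.pi : ℂ) + (d 1 : ℂ) * ((Real.pi : ℂ) * I) + (d 2 : ℂ) * (Real.log Real.pi : ℂ) := by
    rw [hc, hd]; ring
  -- real parts: `-c₁ π = d₀ π + d₂ log π`; imaginary parts: `c₀ π + c₂ log π = d₁ π`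
  have hre := congrArg Complex.re hcmp
  have him := congrArg Complex.im hcmp
  simp only [Complex.mul_re, Complex.mul_im, Complex.I_re, Complex.I_im, (re_im_of_coords c).1,
    (re_im_of_coords c).2, (re_im_of_coords d).1, (re_im_of_coords d).2] at hre him
  -- from the real parts: `(d₀ + c₁) π + d₂ log π = 0` ⟹ `d₂ = 0`, `c₁ = -d₀`
  have h1 := hli (d 0 + c 1) (d 2) (by
    have : ((d 0 + c 1 : ℚ) : ℂ) * (Real.pi : ℂ) + ((d 2 : ℚ) : ℂ) * (Real.log Real.pi : ℂ) = 0 := by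
      have hre' : ((d 0 : ℝ) + (c 1 : ℝ)) * Real.pi + (d 2 : ℝ) * Real.log Real.pi = 0 := by linarith
      exact_mod_cast hre'
    simpa [Rat.smul_def] using this)
  -- from the imaginary parts: `(c₀ - d₁) π + c₂ log π = 0` ⟹ `c₂ = 0`
  have h2 := hli (c 0 - d 1) (c 2) (by
    have : ((c 0 - d 1 : ℚ) : ℂ) * (Real.pi : ℂ) + ((c 2 : ℚ) : ℂ) * (Real.log Real.pi : ℂ) = 0 := by
      have him' : ((c 0 : ℝ) - (d 1 : ℝ)) * Real.pi + (c 2 : ℝ) * Real.log Real.pi = 0 := by linarith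
      exact_mod_cast him'
    simpa [Rat.smul_def] using this)
  -- now `β π = c₀ π + c₁ πi` with `c₂ = 0`; and `β log π ∈ span`: `β log π = e₀ π + e₁ πi + e₂ log π`
  obtain ⟨e, he⟩ := mem_span_piILogPi_iff.mp (hβ 2)
  simp only [piILogPi_two] at he
  have hβ' : β = (c 0 : ℂ) + (c 1 : ℂ) * I := by
    have hπC : (Real.pi : ℂ) ≠ 0 := by exact_mod_cast hπ0
    have : β * (Real.pi : ℂ) = ((c 0 : ℂ) + (c 1 : ℂ) * I) * (Real.pi : ℂ) := by
      rw [← hc, h2.2]; push_cast; ring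
    exact mul_right_cancel₀ hπC this
  -- `(c₀ + c₁ i) log π = e₀ π + e₁ πi + e₂ log π`: imaginary parts give `c₁ log π = e₁ π` ⟹ `c₁ = 0`
  have hcmp2 : ((c 0 : ℂ) + (c 1 : ℂ) * I) * (Real.log Real.pi : ℂ) =
      (e 0 : ℂ) * (Real.pi : ℂ) + (e 1 : ℂ) * ((Real.pi : ℂ) * I) + (e 2 : ℂ) * (Real.log Real.pi : ℂ) := by
    rw [← hβ', he]
  have him2 := congrArg Complex.im hcmp2
  simp only [Complex.mul_im, Complex.add_re, Complex.add_im, Complex.mul_re, Complex.ratCast_re, Complex.ratCast_im,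
    Complex.ofReal_re, Complex.ofReal_im, Complex.I_re, Complex.I_im, (re_im_of_coords e).2] at him2
  have h3 := hli (-e 1) (c 1) (by
    have : ((-e 1 : ℚ) : ℂ) * (Real.pi : ℂ) + ((c 1 : ℚ) : ℂ) * (Real.log Real.pi : ℂ) = 0 := by
      have him2' : -(e 1 : ℝ) * Real.pi + (c 1 : ℝ) * Real.log Real.pi = 0 := by linarith
      exact_mod_cast him2'
    simpa [Rat.smul_def] using this)
  refine ⟨c 0, ?_⟩
  rw [hβ', h3.2]
  simp

/-- `I` is algebraic. -/
private theorem isAlgebraic_I : IsAlgebraic ℚ I :=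
  IsAlgebraic.of_pow (by norm_num : 0 < 2) (by rw [Complex.I_sq]; exact isAlgebraic_one.neg)

/-- **The `πi`-coordinate of an ALGEBRAIC point of `span_ℚ z*` vanishes** (`v − v̄ = 2c₁πi ∈ ℚ̄` forces `c₁ = 0`,
`π ∉ ℚ̄`): the algebraic points of the span are the real points `c₀π + c₂ log π ∈ ℚ̄` (none non-zero under
Schanuel; «`π + log π ∉ ℚ̄`» is open). -/
theorem piILogPi_coord_one_eq_zero {c : Fin 3 → ℚ}
    (halg : IsAlgebraic ℚ ((c 0 : ℂ) * (Real.pi : ℂ) + (c 1 : ℂ) * ((Real.pi : ℂ) * I) +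
      (c 2 : ℂ) * (Real.log Real.pi : ℂ))) : c 1 = 0 := by
  by_contra h1
  set v := (c 0 : ℂ) * (Real.pi : ℂ) + (c 1 : ℂ) * ((Real.pi : ℂ) * I) + (c 2 : ℂ) * (Real.log Real.pi : ℂ)
    with hv
  have hconj : (starRingEnd ℂ) v =
      (c 0 : ℂ) * (Real.pi : ℂ) - (c 1 : ℂ) * ((Real.pi : ℂ) * I) + (c 2 : ℂ) * (Real.log Real.pi : ℂ) := by
    rw [hv]
    simp only [map_add, map_mul, map_ratCast, Complex.conj_ofReal, Complex.conj_I]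
    ring
  have halgc : IsAlgebraic ℚ ((starRingEnd ℂ) v) := halg.algHom (starRingEnd ℂ).toRatAlgHom
  have h1C : (c 1 : ℂ) ≠ 0 := by exact_mod_cast h1
  have hπI : (Real.pi : ℂ) * I = (v - (starRingEnd ℂ) v) * ((((2 : ℚ) * c 1)⁻¹ : ℚ) : ℂ) := by
    rw [hconj, hv]
    push_cast
    field_simp
    ring
  have hπIalg : IsAlgebraic ℚ ((Real.pi : ℂ) * I) := by
    rw [hπI]
    exact (halg.sub halgc).mul (isAlgebraic_algebraMap _)
  refine transcendental_pi_complex ?_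
  have e : (Real.pi : ℂ) = ((Real.pi : ℂ) * I) * (-I) := by
    rw [mul_neg, mul_assoc, Complex.I_mul_I]; ring
  rw [e]
  exact hπIalg.mul isAlgebraic_I.neg

/-- **`dim (span_ℚ z* ∩ ℚ̄) ≤ 1`**: two algebraic points of `span_ℚ (π, πi, log π)` are never ℚ-free (both are real
combinations `c₀π + c₂ log π`; two ℚ-free ones would put `π` in their ℚ-span, inside `ℚ̄`).  So `z*` lies OUTSIDE the
Lindemann–Weierstrass cells of rounds 6/15, which need a ℚ-free algebraic PAIR in the span at length 3. -/
theorem piILogPi_no_algebraic_pair {u v : ℂ}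
    (hu : u ∈ Submodule.span ℚ (Set.range piILogPi)) (hv : v ∈ Submodule.span ℚ (Set.range piILogPi))
    (hua : IsAlgebraic ℚ u) (hva : IsAlgebraic ℚ v) : ¬ LinearIndependent ℚ ![u, v] := by
  intro hli
  obtain ⟨c, hc⟩ := mem_span_piILogPi_iff.mp hu
  obtain ⟨d, hd⟩ := mem_span_piILogPi_iff.mp hv
  have hc1 : c 1 = 0 := piILogPi_coord_one_eq_zero (by rw [hc]; exact hua)
  have hd1 : d 1 = 0 := piILogPi_coord_one_eq_zero (by rw [hd]; exact hva)
  rw [hc1] at hc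
  rw [hd1] at hd
  simp only [Rat.cast_zero, zero_mul, add_zero] at hc hd
  have hpair := LinearIndependent.pair_iff.mp hli
  by_cases hδ : c 0 * d 2 - c 2 * d 0 = 0
  · -- `d₂ u − c₂ v = (c₀d₂ − c₂d₀) π = 0`: a rational relation, so `d₂ = c₂ = 0`, `u = c₀π ∈ ℚ̄`, `u = 0`.
    have hδC : ((c 0 : ℂ) * (d 2 : ℂ) - (c 2 : ℂ) * (d 0 : ℂ)) = 0 := by exact_mod_cast hδ
    have hrel : ((d 2 : ℚ) : ℂ) * u + ((-c 2 : ℚ) : ℂ) * v = 0 := by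
      rw [← hc, ← hd]
      push_cast
      linear_combination (Real.pi : ℂ) * hδC
    obtain ⟨_, h2'⟩ := hpair (d 2) (-c 2) (by simpa [Rat.smul_def] using hrel)
    have hc2 : c 2 = 0 := by simpa using h2'
    rw [hc2] at hc
    simp only [Rat.cast_zero, zero_mul, add_zero] at hc
    have hc0 : c 0 = 0 := by
      by_contra h0
      refine transcendental_pi_complex ?_
      have h0C : (c 0 : ℂ) ≠ 0 := by exact_mod_cast h0
      have e : (Real.pi : ℂ) = u * (((c 0)⁻¹ : ℚ) : ℂ) := by
        rw [← hc]
        push_cast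
        field_simp
      rw [e]
      exact hua.mul (isAlgebraic_algebraMap _)
    have hu0 : u = 0 := by rw [← hc, hc0]; simp
    exact hli.ne_zero 0 (by simpa using hu0)
  · -- `π = (d₂ u − c₂ v)/(c₀d₂ − c₂d₀) ∈ ℚ̄`.
    refine transcendental_pi_complex ?_
    have hδQ : ((c 0 * d 2 - c 2 * d 0 : ℚ) : ℂ) ≠ 0 := by exact_mod_cast hδ
    have e' : ((d 2 : ℚ) : ℂ) * u - ((c 2 : ℚ) : ℂ) * v = (Real.pi : ℂ) * ((c 0 * d 2 - c 2 * d 0 : ℚ) : ℂ) := by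
      rw [← hc, ← hd]
      push_cast
      ring
    have e : (Real.pi : ℂ) =
        (((d 2 : ℚ) : ℂ) * u - ((c 2 : ℚ) : ℂ) * v) * (((c 0 * d 2 - c 2 * d 0)⁻¹ : ℚ) : ℂ) := by
      rw [e', Rat.cast_inv, mul_assoc, mul_inv_cancel₀ hδQ, mul_one]
    rw [e]
    exact (((isAlgebraic_algebraMap _).mul hua).sub ((isAlgebraic_algebraMap _).mul hva)).mul
      (isAlgebraic_algebraMap _)

/-- **VALUE DEGREE OF `z*` IS ≥ 2**: `e^{log π} = π` and `e^{π}` are algebraically independent (Nesterenko). -/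
theorem two_le_valDegree_piILogPi (hN : nesterenko) :
    (2 : Cardinal) ≤ Algebra.trdeg ℚ ↥(adjoin ℚ (Set.range (cexp ∘ piILogPi))) := by
  have hai : AlgebraicIndependent ℚ fun j => cexp (![(Real.log Real.pi : ℂ), (Real.pi : ℂ)] j) := by
    convert algebraicIndependent_pi_exp_pi hN using 1
    funext j
    fin_cases j <;> simp [cexp_log_pi]
  have h := le_valDegree_of_expFamily piILogPi ![(Real.log Real.pi : ℂ), (Real.pi : ℂ)] (fun j => ?_) hai
  · exact_mod_cast h
  fin_cases j
  · simpa using (Submodule.subset_span ⟨2, rfl⟩ : piILogPi 2 ∈ Submodule.span ℚ (Set.range piILogPi))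
  · simpa using (Submodule.subset_span ⟨0, rfl⟩ : piILogPi 0 ∈ Submodule.span ℚ (Set.range piILogPi))

/-- **ARGUMENT DEGREE OF `z*` IS ≥ 1** (`π ∉ ℚ̄`; `= 2` iff `π, log π` are algebraically independent — open). -/
theorem one_le_argDegree_piILogPi :
    (1 : Cardinal) ≤ Algebra.trdeg ℚ ↥(adjoin ℚ (Set.range piILogPi)) :=
  one_le_trdeg_adjoin_of_transcendental transcendental_pi_complex ⟨0, rfl⟩

/-- **ITEM D HOLDS AT `z* = (π, πi, log π)`** (on the disjoint stratum): `3 ≤ trdeg ℚ(π, πi, log π, e^π, −1, π)`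
from `a ≥ 1`, `v ≥ 2` — the value-rich cell's certificate at a member of round 15's residue. -/
theorem disjointSchanuel_piILogPi (hN : nesterenko)
    (hsplit : Algebra.trdeg ℚ ↥(adjoin ℚ (Set.range piILogPi)) +
        Algebra.trdeg ℚ ↥(adjoin ℚ (Set.range (cexp ∘ piILogPi))) ≤
      Algebra.trdeg ℚ ↥(adjoin ℚ (Set.range piILogPi ∪ Set.range (cexp ∘ piILogPi)))) :
    ((3 : ℕ) : Cardinal) ≤ Algebra.trdeg ℚ ↥(adjoin ℚ (Set.range piILogPi ∪ Set.range (cexp ∘ piILogPi))) :=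
  le_trdeg_of_additive_cert _ (a := 1) (v := 2) (by exact_mod_cast one_le_argDegree_piILogPi)
    (by exact_mod_cast two_le_valDegree_piILogPi hN) hsplit (by norm_num)

/-- **MEMBER CERTIFICATE for `z*`** — ℚ-free · PLAIN · no ℚ-free algebraic pair in the span · `a ≥ 1` · `v ≥ 2` ·
item D there under the split.  (What is NOT certified, honestly: an algebraically independent PAIR of arguments —
`trdeg ℚ(π, log π) = 2` is open — and Schanuel's own conclusion at `z*`, see `schanuel_piILogPi_iff`.) -/
theorem member_piILogPi (hN : nesterenko) :
    LinearIndependent ℚ piILogPi ∧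
    (∀ β : ℂ, (∀ i, β * piILogPi i ∈ Submodule.span ℚ (Set.range piILogPi)) → β ∈ Set.range (algebraMap ℚ ℂ)) ∧
    (∀ u v : ℂ, u ∈ Submodule.span ℚ (Set.range piILogPi) → v ∈ Submodule.span ℚ (Set.range piILogPi) →
      IsAlgebraic ℚ u → IsAlgebraic ℚ v → ¬ LinearIndependent ℚ ![u, v]) ∧
    (1 : Cardinal) ≤ Algebra.trdeg ℚ ↥(adjoin ℚ (Set.range piILogPi)) ∧
    (2 : Cardinal) ≤ Algebra.trdeg ℚ ↥(adjoin ℚ (Set.range (cexp ∘ piILogPi))) ∧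
    (Algebra.trdeg ℚ ↥(adjoin ℚ (Set.range piILogPi)) +
          Algebra.trdeg ℚ ↥(adjoin ℚ (Set.range (cexp ∘ piILogPi))) ≤
        Algebra.trdeg ℚ ↥(adjoin ℚ (Set.range piILogPi ∪ Set.range (cexp ∘ piILogPi))) →
      ((3 : ℕ) : Cardinal) ≤ Algebra.trdeg ℚ ↥(adjoin ℚ (Set.range piILogPi ∪ Set.range (cexp ∘ piILogPi)))) :=
  ⟨piILogPi_linearIndependent hN, fun _ hβ => piILogPi_plain hN hβ,
    fun _ _ hu hv hua hva => piILogPi_no_algebraic_pair hu hv hua hva, one_le_argDegree_piILogPi,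
    two_le_valDegree_piILogPi hN, disjointSchanuel_piILogPi hN⟩

/-- **… while SCHANUEL AT `z*` IS `3 ≤ trdeg ℚ(π, e^π, log π)` — OPEN** (it says `π, e^π, log π` are algebraically
independent; Nesterenko gives `2`).  Precisely: the total field of `z*` has the same transcendence degree as
`ℚ(π, e^π, log π)`. -/
theorem schanuel_piILogPi_iff :
    ((3 : ℕ) : Cardinal) ≤ Algebra.trdeg ℚ ↥(adjoin ℚ (Set.range piILogPi ∪ Set.range (cexp ∘ piILogPi))) ↔
      ((3 : ℕ) : Cardinal) ≤ Algebra.trdeg ℚ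
        ↥(adjoin ℚ ({(Real.pi : ℂ), cexp (Real.pi : ℂ), (Real.log Real.pi : ℂ)} : Set ℂ)) := by
  set K := adjoin ℚ ({(Real.pi : ℂ), cexp (Real.pi : ℂ), (Real.log Real.pi : ℂ)} : Set ℂ) with hK
  have hπ : (Real.pi : ℂ) ∈ K := subset_adjoin ℚ _ (by simp)
  have he : cexp (Real.pi : ℂ) ∈ K := subset_adjoin ℚ _ (by simp)
  have hl : (Real.log Real.pi : ℂ) ∈ K := subset_adjoin ℚ _ (by simp)
  have hle : Algebra.trdeg ℚ ↥(adjoin ℚ (Set.range piILogPi ∪ Set.range (cexp ∘ piILogPi))) ≤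
      Algebra.trdeg ℚ ↥K := by
    refine trdeg_adjoin_le_of_isAlgebraic ?_
    rintro x (⟨i, rfl⟩ | ⟨i, rfl⟩) <;> fin_cases i
    · simpa using isAlgebraic_of_mem_adjoin hπ
    · simpa using isAlgebraic_mul (isAlgebraic_of_mem_adjoin hπ) (isAlgebraic_I.tower_top K)
    · simpa using isAlgebraic_of_mem_adjoin hl
    · simpa using isAlgebraic_of_mem_adjoin he
    · simpa [Complex.exp_pi_mul_I] using (isAlgebraic_one (R := ↥K) (A := ℂ)).neg
    · simpa [cexp_log_pi] using isAlgebraic_of_mem_adjoin hπ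
  have hge : K ≤ adjoin ℚ (Set.range piILogPi ∪ Set.range (cexp ∘ piILogPi)) := by
    rw [hK, adjoin_le_iff]
    rintro x (rfl | rfl | rfl)
    · exact subset_adjoin ℚ _ (Or.inl ⟨0, rfl⟩)
    · exact subset_adjoin ℚ _ (Or.inr ⟨0, rfl⟩)
    · exact subset_adjoin ℚ _ (Or.inl ⟨2, rfl⟩)
  have hge' : Algebra.trdeg ℚ ↥K ≤
      Algebra.trdeg ℚ ↥(adjoin ℚ (Set.range piILogPi ∪ Set.range (cexp ∘ piILogPi))) :=
    Literature.NumberTheory.Transcendental.OneMotiveToric.trdeg_mono hge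
  constructor
  · exact fun h => h.trans hle
  · exact fun h => h.trans hge'

end Summit.Schanuel.Schanuel.Theorems.RootDecomp1ResidueSieve
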